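import Literature.Computability.Complexity.GateEliminationTransfer
import Literature.Computability.Complexity.GateEliminationAffineGates
import Literature.Computability.Complexity.GateEliminationOutput

/-!
# Gate elimination, XX: affine substitution in a semicircuit (`x_j := x_k ⊕ c`)

Circuit side of Li–Yang's affine substitution (STOC 2022; full version ECCC TR21-023, §2.4:
"we can rewire all the gates fed by `x_j` to be fed by `x_k`, and change the function computed by
these gates accordingly, to replace `x_j` by `x_k ⊕ 1`"), the companion of `RdqSource.assignLin`
(`GateEliminationAssignLin.lean`). Everything is PROVED.

* `Node.substVar`, `Semicircuit.substVar C j k c` — wires from `x_j` moved to `x_k`, the reading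
  positions negated if `c`; fairness preserved (`Fair.substVar`: solutions are those of `C` on the
  input updated at `x_j := x_k ⊕ c`), `f|_{R'}` computed for a source with the extra equation
  `x_j = x_k + c` when the output is not `x_j` (`ComputesRestr.substVar`), out-degrees
  (`x_j` becomes a `0`-variable, `x_k` inherits its wires), ∧-types unchanged, new troubled
  gates caused by `x_k` (`causedBy_of_new_troubled_substVar`), `Φ' ≤ Φ + 1`
  (`exists_packing_substVar`), influential inputs afterwards `⊆ insert k (influential ∖ {j})`.

## References

* J. Li, T. Yang, *3.1n − o(n) circuit lower bounds for explicit functions*, STOC 2022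
  [LiYang2022]; full version ECCC TR21-023, §2.4, Prop. 2.6, §3.3.
-/

namespace Literature.Computability.Complexity

open Finset

namespace Node

variable {n m : ℕ}

/-- Replace the variable node `x_j` by the variable node `x_k`. [cite: LiYang2022, §2.4] -/
def substVar (j k : Fin n) : Node n m → Node n m
  | .var i => if i = j then .var k else .var i
  | v => v

/-- Substitution on a constant. [folklore] -/
@[simp] theorem substVar_const (j k : Fin n) (b : Bool) : (Node.const b : Node n m).substVar j k = .const b := rfl

/-- Substitution on a gate. [folklore] -/
@[simp] theorem substVar_gate (j k : Fin n) (g : Fin m) : (Node.gate g : Node n m).substVar j k = .gate g := rfl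

/-- Substitution on `x_j`. [folklore] -/
@[simp] theorem substVar_var_self (j k : Fin n) : (Node.var j : Node n m).substVar j k = .var k := by
  simp [substVar]

/-- Substitution on another variable. [folklore] -/
theorem substVar_var_of_ne {j i : Fin n} (h : i ≠ j) (k : Fin n) : (Node.var i : Node n m).substVar j k = .var i := by
  simp [substVar, h]

/-- A node other than `x_j` is unchanged. [folklore] -/
theorem substVar_of_ne {j : Fin n} {v : Node n m} (h : v ≠ .var j) (k : Fin n) : v.substVar j k = v := by
  cases v with
  | const b => rfl
  | var i => exact substVar_var_of_ne (fun hij => h (by rw [hij])) k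
  | gate g => rfl

/-- The result is a gate iff the node was that gate. [folklore] -/
theorem substVar_eq_gate_iff {j k : Fin n} {v : Node n m} {g : Fin m} : v.substVar j k = .gate g ↔ v = .gate g := by
  cases v with
  | const b => simp
  | var i => by_cases h : i = j <;> simp [substVar, h]
  | gate g' => simp

/-- `x_j` no longer occurs (for `k ≠ j`). [folklore] -/
theorem substVar_ne_var_self {j k : Fin n} (hjk : k ≠ j) (v : Node n m) : v.substVar j k ≠ .var j := by
  cases v with
  | const b => simp
  | var i =>
    by_cases h : i = j
    · subst h; rw [substVar_var_self]; exact fun h' => hjk (Node.var.inj h')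
    · rw [substVar_var_of_ne h]; exact fun h' => h (Node.var.inj h')
  | gate g => simp

/-- The result is `x_i` for `i ≠ j, k` iff the node was `x_i`. [folklore] -/
theorem substVar_eq_var_iff_of_ne {j k i : Fin n} (hij : i ≠ j) (hik : i ≠ k) {v : Node n m} :
    v.substVar j k = .var i ↔ v = .var i := by
  cases v with
  | const b => simp
  | var i' =>
    by_cases h : i' = j
    · subst h; rw [substVar_var_self]; simp only [Node.var.injEq]
      exact ⟨fun h' => absurd h'.symm hik, fun h' => absurd h'.symm hij⟩
    · rw [substVar_var_of_ne h]
  | gate g => simp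

/-- The result is `x_k` iff the node was `x_j` or `x_k`. [folklore] -/
theorem substVar_eq_var_target_iff {j k : Fin n} {v : Node n m} :
    v.substVar j k = .var k ↔ v = .var j ∨ v = .var k := by
  cases v with
  | const b => simp
  | var i' =>
    by_cases h : i' = j
    · subst h; simp
    · rw [substVar_var_of_ne h]; simp [h]
  | gate g => simp

end Node

namespace Semicircuit

variable {n : ℕ} (C : Semicircuit n)

/-- **Affine substitution `x_j := x_k ⊕ c` in a semicircuit** (Li–Yang §2.4: "we can rewire all
the gates fed by `x_j` to be fed by `x_k`, and change the function computed by these gates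
accordingly, to replace `x_j` by `x_k ⊕ 1`"): wires from `x_j` go to `x_k`, the positions that
read `x_j` are negated if `c`; the output, if it was `x_j`, becomes `x_k` (only meaningful for
`c = false`; in use the output is a gate). [cite: LiYang2022, §2.4] -/
abbrev substVar (j k : Fin n) (c : Bool) : Semicircuit n where
  m := C.m
  op g b₀ b₁ := C.op g (b₀ ^^ (c && decide (C.arg g 0 = .var j))) (b₁ ^^ (c && decide (C.arg g 1 = .var j)))
  arg g a := (C.arg g a).substVar j k
  out := C.out.substVar j k
  xorPart := C.xorPart
  isXorOp_of_mem g hg := (C.isXorOp_of_mem g hg).comp_xor _ _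
  mem_of_arg_eq g hg a g' h := C.mem_of_arg_eq g hg a g' (Node.substVar_eq_gate_iff.mp h)
  acyclic := by
    obtain ⟨ρ, hρ⟩ := C.acyclic
    exact ⟨ρ, fun g hg a g' h hg' => hρ g hg a g' (Node.substVar_eq_gate_iff.mp h) hg'⟩

section SubstVar

variable (j k : Fin n) (c : Bool)

/-- Wires after substitution. [folklore] -/
theorem substVar_arg (g : Fin C.m) (a : Fin 2) : (C.substVar j k c).arg g a = (C.arg g a).substVar j k := rfl

/-- Node values are computed by the same function. [folklore] -/
theorem nodeVal_substVar_eq (x : Fin n → Bool) (w : Fin C.m → Bool) (v : Node n C.m) :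
    (C.substVar j k c).nodeVal x w v = C.nodeVal x w v := by
  cases v <;> rfl

/-- **Node values after substitution**, read through the compensating negation, are the old
node values on the input updated at `x_j := x_k ⊕ c`. [folklore] -/
theorem nodeVal_substVar (x : Fin n → Bool) (w : Fin C.m → Bool) (v : Node n C.m) :
    (C.nodeVal x w (v.substVar j k) ^^ (c && decide (v = .var j))) =
      C.nodeVal (Function.update x j (x k ^^ c)) w v := by
  cases v with
  | const b => simp [nodeVal]
  | var i =>
    by_cases h : i = j
    · subst h
      rw [Node.substVar_var_self, decide_eq_true rfl, Bool.and_true]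
      simp [nodeVal]
    · rw [Node.substVar_var_of_ne h, decide_eq_false (fun h' => h (Node.var.inj h')), Bool.and_false, Bool.xor_false]
      simp [nodeVal, h]
  | gate g => simp [nodeVal]

/-- **Gate equations after substitution** are the old ones on the updated input. [folklore] -/
theorem consistent_substVar_iff (x : Fin n → Bool) (w : Fin C.m → Bool) :
    (C.substVar j k c).Consistent x w ↔ C.Consistent (Function.update x j (x k ^^ c)) w := by
  unfold Consistent
  simp only [nodeVal_substVar_eq, nodeVal_substVar]

variable {C} in
/-- **Affine substitution preserves fairness.** [cite: LiYang2022, Prop. 2.6] -/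
theorem Fair.substVar (hF : C.Fair) : (C.substVar j k c).Fair := fun x => by
  obtain ⟨w, hw, huniq⟩ := hF (Function.update x j (x k ^^ c))
  exact ⟨w, (C.consistent_substVar_iff j k c x w).mpr hw,
    fun w' hw' => huniq w' ((C.consistent_substVar_iff j k c x w').mp hw')⟩

/-- Out-degrees of gates are unchanged. [folklore] -/
theorem fanout_substVar_gate (g : Fin C.m) : (C.substVar j k c).fanout (.gate g) = C.fanout (.gate g) := by
  unfold fanout
  refine Finset.sum_congr rfl fun g' _ => ?_
  congr 1; ext a
  simp [Node.substVar_eq_gate_iff]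

/-- Out-degrees of variables other than `x_j`, `x_k` are unchanged. [folklore] -/
theorem fanout_substVar_var_of_ne {i : Fin n} (hij : i ≠ j) (hik : i ≠ k) :
    (C.substVar j k c).fanout (.var i) = C.fanout (.var i) := by
  unfold fanout
  refine Finset.sum_congr rfl fun g' _ => ?_
  congr 1; ext a
  simp only [mem_filter, mem_univ, true_and]
  exact Node.substVar_eq_var_iff_of_ne hij hik

/-- **`x_j` becomes a `0`-variable** (for `k ≠ j`). [cite: LiYang2022, §2.4] -/
theorem fanout_substVar_var_self (hjk : k ≠ j) : (C.substVar j k c).fanout (.var j) = 0 := by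
  unfold fanout
  refine Finset.sum_eq_zero fun g' _ => ?_
  rw [Finset.card_eq_zero, Finset.filter_eq_empty_iff]
  intro a _
  exact Node.substVar_ne_var_self hjk _

/-- **`x_k` inherits the wires of `x_j`.** [cite: LiYang2022, §2.4] -/
theorem fanout_substVar_var_target (hjk : k ≠ j) :
    (C.substVar j k c).fanout (.var k) = C.fanout (.var k) + C.fanout (.var j) := by
  unfold fanout
  rw [← sum_add_distrib]
  refine sum_congr rfl fun g _ => ?_
  rw [← card_union_of_disjoint]
  · congr 1; ext a
    simp only [mem_filter, mem_univ, true_and, mem_union]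
    rw [Node.substVar_eq_var_target_iff]; tauto
  · rw [disjoint_filter]; intro a _ h1 h2; rw [h1] at h2; exact hjk (Node.var.inj h2)

/-! #### Computing `f|_R'` -/

variable {C j k c} in
/-- **Affine substitution computes `f` on the restricted source**: if `C` computes `f|_R` with an
output that is not `x_j`, and `R'` is `R` with the extra equation `x_j = x_k + c'` (solutions
`Sol R ∩ {x_j = x_k + c'}`, free variables those of `R` but `x_j`, e.g.
`R.assignLin j ⟨{k}, c'⟩ …`), then `C[x_j := x_k ⊕ c]`, `c = finTwoEquiv c'`, computes `f|_{R'}`.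
[cite: LiYang2022, §2.4, Prop. 2.6] -/
theorem ComputesRestr.substVar {f : (Fin n → ZMod 2) → Bool} {R R' : RdqSource n}
    (hC : C.ComputesRestr f R) {j k : Fin n} (hjk : k ≠ j) {c' : ZMod 2}
    (hsol : ∀ v, v ∈ R'.Sol ↔ v ∈ R.Sol ∧ v j = v k + c') (hfree : ∀ i, R'.Free i ↔ R.Free i ∧ i ≠ j)
    (hkfree : R.Free k) (hout : C.out ≠ .var j) :
    (C.substVar j k (finTwoEquiv c')).ComputesRestr f R' := by
  refine ⟨fun i hi => ?_, fun v hv w hw => ?_⟩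
  · by_cases hij : i = j
    · subst hij; exact C.fanout_substVar_var_self i k _ hjk
    · have hik : i ≠ k := fun h => hi ((hfree i).mpr ⟨h ▸ hkfree, hij⟩)
      rw [C.fanout_substVar_var_of_ne j k _ hij hik]
      exact hC.1 i fun hf => hi ((hfree i).mpr ⟨hf, hij⟩)
  · obtain ⟨hvR, hvj⟩ := (hsol v).mp hv
    have hx : Function.update (boolOfZMod2.symm v) j (boolOfZMod2.symm v k ^^ finTwoEquiv c') = boolOfZMod2.symm v := by
      have : (boolOfZMod2.symm v k ^^ finTwoEquiv c') = boolOfZMod2.symm v j := by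
        rw [Circuit.boolOfZMod2_symm_apply, Circuit.boolOfZMod2_symm_apply, hvj, finTwoEquiv_add]
      rw [this]; exact Function.update_eq_self j _
    rw [C.consistent_substVar_iff, hx] at hw
    rw [nodeVal_substVar_eq]
    have h := C.nodeVal_substVar j k (finTwoEquiv c') (boolOfZMod2.symm v) w C.out
    rw [hx, hC.2 v hvR w hw, decide_eq_false hout, Bool.and_false, Bool.xor_false] at h
    exact h

/-! #### Troubled gates and the potential after an affine substitution -/

/-- ∧-types are unchanged by the compensating negations. [folklore] -/
theorem isAndOp_substVar_iff (g : Fin C.m) : IsAndOp ((C.substVar j k c).op g) ↔ IsAndOp (C.op g) :=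
  isAndOp_comp_xor_iff (C.op g) _ _

/-- A gate reading the variable `z ≠ j` still reads it. [folklore] -/
theorem reads_var_substVar_of_ne {g : Fin C.m} {z : Fin n} (hz : z ≠ j) (h : ∃ a, C.arg g a = .var z) :
    ∃ a, (C.substVar j k c).arg g a = .var z := by
  obtain ⟨a, ha⟩ := h
  exact ⟨a, by rw [substVar_arg, ha, Node.substVar_var_of_ne hz]⟩

/-- A gate reading `x_j` now reads `x_k`. [folklore] -/
theorem reads_target_substVar_of_reads {g : Fin C.m} (h : ∃ a, C.arg g a = .var j) :
    ∃ a, (C.substVar j k c).arg g a = .var k := by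
  obtain ⟨a, ha⟩ := h
  exact ⟨a, by rw [substVar_arg, ha, Node.substVar_var_self]⟩

/-- **New troubled gates after an affine substitution are caused by `x_k`** (a gate whose wires
or whose variables' out-degrees changed reads `x_j` — now `x_k` — or `x_k`). [cite: LiYang2022, §2.4] -/
theorem causedBy_of_new_troubled_substVar (hjk : k ≠ j) {g : Fin C.m}
    (hT' : (C.substVar j k c).Troubled g) (hT : ¬ C.Troubled g) :
    CausedBy C (C.substVar j k c) id (.var k) g := by
  by_contra hcon
  unfold CausedBy at hcon
  push Not at hcon
  have hnk : ∀ a, (C.substVar j k c).arg g a ≠ .var k := fun a h => hcon.2 k rfl a h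
  -- `g` reads neither `x_j` nor `x_k` in `C`
  have hnj : ∀ a, C.arg g a ≠ .var j := fun a h =>
    hnk a (by rw [substVar_arg, h, Node.substVar_var_self])
  have hnk' : ∀ a, C.arg g a ≠ .var k := fun a h =>
    hnk a (by rw [substVar_arg, h, Node.substVar_var_of_ne hjk])
  have hargs : (C.substVar j k c).arg g = C.arg g := funext fun a => Node.substVar_of_ne (hnj a) k
  obtain ⟨hand, h1, x, y, hxy, hr, hx, hy⟩ := hT'
  rw [hargs] at hr
  have hxj : x ≠ j := fun h => by
    have : (Node.var x : Node n C.m) ∈ Set.range (C.arg g) := by rw [hr]; simp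
    obtain ⟨a, ha⟩ := this; exact hnj a (h ▸ ha)
  have hyj : y ≠ j := fun h => by
    have : (Node.var y : Node n C.m) ∈ Set.range (C.arg g) := by rw [hr]; simp
    obtain ⟨a, ha⟩ := this; exact hnj a (h ▸ ha)
  have hxk : x ≠ k := fun h => by
    have : (Node.var x : Node n C.m) ∈ Set.range (C.arg g) := by rw [hr]; simp
    obtain ⟨a, ha⟩ := this; exact hnk' a (h ▸ ha)
  have hyk : y ≠ k := fun h => by
    have : (Node.var y : Node n C.m) ∈ Set.range (C.arg g) := by rw [hr]; simp
    obtain ⟨a, ha⟩ := this; exact hnk' a (h ▸ ha)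
  apply hT
  refine ⟨(C.isAndOp_substVar_iff j k c g).mp hand, ?_, x, y, hxy, hr, ?_, ?_⟩
  · rw [← C.fanout_substVar_gate j k c g]; exact h1
  · rw [← C.fanout_substVar_var_of_ne j k c hxj hxk]; exact hx
  · rw [← C.fanout_substVar_var_of_ne j k c hyj hyk]; exact hy

/-- **Affine substitution accounting**: `Φ' ≤ Φ + 1` for a suitable packing of the new circuit.
[cite: LiYang2022, §2.4, §3.3] -/
theorem exists_packing_substVar (hjk : k ≠ j) {P : Finset (Fin C.m × Fin C.m)} (hP : C.IsPacking P) :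
    ∃ P' : Finset (Fin C.m × Fin C.m), (C.substVar j k c).IsPacking P' ∧
      (C.substVar j k c).potential P' ≤ C.potential P + 1 := by
  classical
  set C' := C.substVar j k c
  set A : Finset (Fin C.m) := univ.filter fun g => C'.Troubled g ∧ CausedBy C C' id (.var k) g with hA
  have hAgood : C'.GoodCover A := goodCover_causedBy C C' id (fun _ _ h => h) _ A fun g hg => (mem_filter.mp hg).2
  have hcover : ∀ g, C'.Troubled g → ¬ C.Troubled (id g) → g ∈ A ∨ g ∈ (∅ : Finset (Fin C.m)) :=
    fun g hg hgT => Or.inl (mem_filter.mpr ⟨mem_univ _, hg, C.causedBy_of_new_troubled_substVar j k c hjk hg hgT⟩)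
  have hadj : ∀ g g', C'.Troubled g → C'.Troubled g' → C.Troubled (id g) → C.Troubled (id g') →
      C.Adjacent (id g) (id g') → C'.Adjacent g g' := by
    intro g g' _ _ _ _ ⟨z, hz, hz'⟩
    by_cases hzj : z = j
    · subst hzj
      exact ⟨k, C.reads_target_substVar_of_reads z k c hz, C.reads_target_substVar_of_reads z k c hz'⟩
    · exact ⟨z, C.reads_var_substVar_of_ne j k c hzj hz, C.reads_var_substVar_of_ne j k c hzj hz'⟩
  obtain ⟨P', hP', hpot⟩ := exists_packing_transfer C C' id (fun _ _ h => h) hP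
    (fun p _ => ⟨⟨p.1, rfl⟩, ⟨p.2, rfl⟩⟩) hadj A ∅ hcover hAgood (Or.inl (by simp))
  refine ⟨P', hP', hpot.trans ?_⟩
  have h1 : ((if A = ∅ then 0 else 1 : ℕ) : ℝ) ≤ 1 := by exact_mod_cast ite_empty_le_one A
  have h2 : ((if (∅ : Finset (Fin C.m)) = ∅ then 0 else 1 : ℕ) : ℝ) = 0 := by simp
  linarith

/-- **Influential inputs after an affine substitution** to `x_j` with a new source in which
`x_j` is not free and which protects no new variable: among the old ones minus `x_j`, except that
`x_k` may become influential (if it was a `0`-variable that now inherits wires). [cite: LiYang2022, Def. 3.6] -/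
theorem influential_substVar_subset {R R' : RdqSource n} (hjk : k ≠ j) (hfreej : ¬ R'.Free j)
    (hprot : ∀ i, R'.Protected i → R.Protected i) :
    (C.substVar j k c).influential R' ⊆ insert k ((C.influential R).erase j) := by
  classical
  intro i hi
  unfold influential at hi
  rw [mem_filter] at hi
  rw [mem_insert, mem_erase]
  by_cases hik : i = k
  · exact Or.inl hik
  · right
    have hij : i ≠ j := by
      rintro rfl
      rcases hi.2 with h | h
      · rw [C.fanout_substVar_var_self i k c hjk] at h; exact absurd h (by norm_num)
      · exact hfreej h.1
    refine ⟨hij, ?_⟩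
    unfold influential; rw [mem_filter]
    refine ⟨mem_univ _, ?_⟩
    rcases hi.2 with h | h
    · rw [C.fanout_substVar_var_of_ne j k c hij hik] at h; exact Or.inl h
    · exact Or.inr (hprot i h)

end SubstVar

end Semicircuit

end Literature.Computability.Complexity
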